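import Literature.NumberTheory.LFunctions.Zhang2022.KnifeEdgeEStarLen
import Literature.NumberTheory.LFunctions.Zhang2022.MainTermFormEll
import HarnessLib

/-!
# Zhang (2022) §2 at FREE SCALES: the parameter record behind the knife edge `ℓ₀ = 1`
# (cell `landau-siegel`, §D edge ell / §B-ell; INFRASTRUCTURE — definitions only, no claim)

Topic `Literature/NumberTheory/LFunctions/Zhang2022` (Landau–Siegel audit tree; verdict-neutral).
Y. Zhang, arXiv:2211.02515v1 (2022) [Zhang2022LandauSiegel] — an unrefereed manuscript under
adjudication; NOTHING here asserts or denies its Theorems 1–2, and nothing here is a claim about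
Landau–Siegel zeros.

WHY THIS FILE. Every object of the typed skeleton (`Skeleton.*`) is a function of `D` with the manuscript's
scales PINNED (`P = exp 𝓛⁹`, `T = exp 𝓛^{1.1}`, `t₀ = 𝓛⁵¹⁹`, `𝓛₁ = 𝓛⁴⁰⁵`, `𝓛₂ = 𝓛⁴⁰⁰`, window `𝓛⁻⁶⁸`;
`𝓛 = log D`). The knife edge `ℓ₀ = 1` (`mainTermFormEll_neg_of_one_lt`; custodians' KNIFE-EDGES §1 / LEVERS L11)
concerns the regime `P = D^A`, `A` FIXED, where the lengths `L_M = log P` (mollifier), `L_Δ = log(p√D·t₀)` (zero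
spacing: gap `π/L_Δ`) and `L_R = log(pDt₀/2π)` (reflection: conductor `pD`) no longer merge and the invariant edge
parameter is `ℓ = L_R/L_Δ ≈ 1 + 1/(2A+1)`; inside the pinned skeleton `ℓ ≡ 1 + O(𝓛⁻⁸)`, so no statement "at `P = D^A`"
(zero model to relative precision `c/A`, main-term dictionary to relative error `c/A`, `D`-uniform bounds at
`T = D^B`) can be written over `Skeleton.*`. This file supplies the missing vocabulary and NOTHING ELSE:
* `Scales = (D; log P, log T, t₀, 𝓛₁, 𝓛₂, η)` with `P, T, α = π/log P, P₄, α̃, A = log P/log D, B`, the pinned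
  record `Scales.pinned D` (`pinned_P : (pinned D).P = Skeleton.bigP D`, …, so nothing is restated), and the three
  lengths `LDelta`, `LRefl`, `ell` with `one_lt_ell` (`ℓ > 1` once `D > 4π²`) and `ell_sub_one`;
* the family at scale `S`: `primeWindow`, `Chr S = ⟨p, ψ primitive mod p⟩`, `frakP`, the zero window `zeroSet`
  ((2.14), `t₀, 𝓛₁` free), `prodZeroSet` (Prop. 2.2's set), the shifts `β_j` ((2.13), `α = π/log P`), `𝔠*(ρ,ψ)`
  (the formula of `Skeleton.cstar`), `ω = SmoothWeight.omega 𝓛₂ t₀`;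
* the profile polynomial `profPoly χ x g N s = Σ_{1≤n<N} ψχ(n)·g(log n/log P)·n^{−s}` and the discrete mean /
  polar pairing `discMean c' S F u`, `discPolar c' S F u v` over a CHOSEN finite sub-family `F` (free-scale twins
  of `KnifeEdge.profPoly` / `KnifeEdge.discMean` of `KnifeEdgeEStarLen`, the cell's pinned vocabulary of record,
  which sums over `Skeleton.idx χ = Ψ₁ × zeros` — at free scales `Ψ₁`'s inequalities (3.4)–(3.6) carry pinned
  exponents, so the sub-family is a parameter), the normaliser `𝔞·𝔓` (`Lemma171.frakA χ`, pure-`D`) and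
  `profileMean`; `Chr.pinnedEquiv : Chr (pinned D) ≃ Skeleton.Chr D` and the `pinned_*` lemmas identify every
  object with the skeleton's / `KnifeEdge`'s at the manuscript's scales.

Deliberately NOT here: any `Prop` (zero model, dictionary, (14.8)-type bounds are ONE-LINERS over this vocabulary,
stated by whoever claims them with explicit `(c, A₀, range)`), the §14 objects (`Typed.Sec14.lhs148` at free
`(P, T)`: registry row E-016 `Eq148DUniform`), and every numerical value of record.

## References
* Y. Zhang, arXiv:2211.02515v1 (2022), §2 (2.6)–(2.19), (2.23)–(2.31); §6 (`T`, `P₄`).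
  [cite: Zhang2022LandauSiegel, §2]
-/

noncomputable section

open Complex Real ComplexConjugate

namespace Literature.NumberTheory.LFunctions.Zhang2022.EllScales

/-! ## The scale record -/

/-- **Free scales for Zhang's §2.** `D` = modulus of the exceptional character (`𝓛 = log D`); `logP` = the
mollifier unit `L_M = log P` ((2.6) pins `𝓛⁹`); `logT = log T` (§6 pins `𝓛^{1.1}`); `t0` = the height
((2.8) pins `𝓛⁵¹⁹`); `L1 = 𝓛₁` = half-height of `Ω` / of the zero window ((2.8) pins `𝓛⁴⁰⁵`); `L2 = 𝓛₂` =
width of `ω` ((2.15) pins `𝓛⁴⁰⁰`); `eta` = relative width of the prime window `p ∈ (P, P(1+η))` (§2 p. 4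
pins `𝓛⁻⁶⁸`). [cite: Zhang2022LandauSiegel, §2 (2.6)–(2.10), (2.15); §6] -/
structure Scales where
  /-- the modulus `D` of `χ` -/
  D : ℕ
  /-- `L_M = log P` -/
  logP : ℝ
  /-- `log T` -/
  logT : ℝ
  /-- the height `t₀` -/
  t0 : ℝ
  /-- `𝓛₁`, half-height of the zero window -/
  L1 : ℝ
  /-- `𝓛₂`, width of the weight `ω` -/
  L2 : ℝ
  /-- `η`, relative width of the prime window -/
  eta : ℝ

namespace Scales

variable (S : Scales)

/-- `𝓛 = log D` (2.1) — the skeleton's `Skeleton.ell D`; named `logD` here because in this file `ell` is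
reserved for the edge parameter `ℓ = L_R/L_Δ`. [cite: Zhang2022LandauSiegel, §2 (2.1)] -/
def logD : ℝ := Real.log S.D

/-- `P = exp(L_M)` (2.6). [cite: Zhang2022LandauSiegel, §2 (2.6)] -/
def P : ℝ := Real.exp S.logP

/-- `T = exp(log T)` (§6). [cite: Zhang2022LandauSiegel, §6] -/
def T : ℝ := Real.exp S.logT

/-- `α = π/log P` (2.10): the dictionary's zero gap. [cite: Zhang2022LandauSiegel, §2 (2.10)] -/
def alpha : ℝ := π / S.logP

/-- `P₄ = PT⁻²t₀` (§6). [cite: Zhang2022LandauSiegel, §6] -/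
def P4 : ℝ := S.P / S.T ^ 2 * S.t0

/-- `α̃ = log(Dt₀)/log P` (2.30): the band width. [cite: Zhang2022LandauSiegel, §2 (2.30)] -/
def alphaTilde : ℝ := Real.log (S.D * S.t0) / S.logP

/-- The regime exponent `A = log P/log D` (`P = D^A`). [cite: Zhang2022LandauSiegel, §2 (2.6)] -/
def A : ℝ := S.logP / Real.log S.D

/-- The regime exponent `B = log T/log D` (`T = D^B`). [cite: Zhang2022LandauSiegel, §6] -/
def B : ℝ := S.logT / Real.log S.D

/-- **The manuscript's pinned scales**: `log P = 𝓛⁹`, `log T = 𝓛^{1.1}`, `t₀ = 𝓛⁵¹⁹`, `𝓛₁ = 𝓛⁴⁰⁵`,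
`𝓛₂ = 𝓛⁴⁰⁰`, `η = 𝓛⁻⁶⁸`. [cite: Zhang2022LandauSiegel, §2 (2.6), (2.8), (2.15); §6] -/
def pinned (D : ℕ) : Scales where
  D := D
  logP := Real.log D ^ 9
  logT := Real.log D ^ (1.1 : ℝ)
  t0 := Real.log D ^ 519
  L1 := Real.log D ^ 405
  L2 := Real.log D ^ 400
  eta := (Real.log D ^ 68)⁻¹

/-- `(pinned D).P = Skeleton.bigP D`. [cite: Zhang2022LandauSiegel, §2 (2.6)] -/
theorem pinned_P (D : ℕ) : (pinned D).P = Skeleton.bigP D := rfl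
/-- `(pinned D).T = Skeleton.bigT D`. [cite: Zhang2022LandauSiegel, §6] -/
theorem pinned_T (D : ℕ) : (pinned D).T = Skeleton.bigT D := rfl
/-- `(pinned D).t0 = Skeleton.t0 D`. [cite: Zhang2022LandauSiegel, §2 (2.8)] -/
theorem pinned_t0 (D : ℕ) : (pinned D).t0 = Skeleton.t0 D := rfl

/-- `(pinned D).L1 = Skeleton.ell1 D`, `(pinned D).L2 = Skeleton.ell2 D`. [cite: Zhang2022LandauSiegel, §2 (2.8), (2.15)] -/
theorem pinned_L1_L2 (D : ℕ) : (pinned D).L1 = Skeleton.ell1 D ∧ (pinned D).L2 = Skeleton.ell2 D := ⟨rfl, rfl⟩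

/-- `(pinned D).alpha = Skeleton.alpha D`. [cite: Zhang2022LandauSiegel, §2 (2.10)] -/
theorem pinned_alpha (D : ℕ) : (pinned D).alpha = Skeleton.alpha D := by
  rw [alpha, Skeleton.alpha, ← pinned_P, P, Real.log_exp]

/-- `(pinned D).P4 = Skeleton.P4 D`. [cite: Zhang2022LandauSiegel, §6] -/
theorem pinned_P4 (D : ℕ) : (pinned D).P4 = Skeleton.P4 D := rfl
/-- `(pinned D).alphaTilde = Skeleton.alphaTilde D`. [cite: Zhang2022LandauSiegel, §2 (2.30)] -/
theorem pinned_alphaTilde (D : ℕ) : (pinned D).alphaTilde = Skeleton.alphaTilde D := by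
  rw [alphaTilde, Skeleton.alphaTilde, ← pinned_P, P, Real.log_exp]; rfl

/-- In the pinned regime `A = 𝓛⁸` (for `log D ≠ 0`): the manuscript's `P` is `D^{𝓛⁸}`.
[cite: Zhang2022LandauSiegel, §2 (2.6)] -/
theorem pinned_A {D : ℕ} (hD : Real.log D ≠ 0) : (pinned D).A = Real.log D ^ 8 := by
  rw [A, pinned]
  field_simp

/-! ## The three lengths of the ℓ-edge -/

/-- Zero-spacing unit `L_Δ(p) = log(p√D·t₀)`: near height `2πt₀` the zeros of `L(s,ψ)L(s,ψχ)`
(conductors `p` and `pD`) have mean gap `2π/log(Dp²t₀²) = π/L_Δ` ((2.10): "`≃ α(1+O(α𝓛))`" in the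
pinned regime). [cite: Zhang2022LandauSiegel, §2 (2.10) p.4] -/
def LDelta (p : ℝ) : ℝ := Real.log (p * Real.sqrt S.D * S.t0)

/-- Reflection unit `L_R(p) = log(pDt₀/2π)`: the functional equation of `L(s,ψχ)` (conductor `pD`) at
height `≍ 2πt₀` maps `n ↔ pDt₀/n` ((2.2), (2.30): the reflection partner's shift `α̃`). [cite: Zhang2022LandauSiegel, §2 (2.2), (2.30)] -/
def LRefl (p : ℝ) : ℝ := Real.log (p * S.D * S.t0 / (2 * π))

/-- **The edge parameter `ℓ(p) = L_R/L_Δ`** — the `ℓ` of `mainTermFormEll ℓ` in the frame where the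
reflection sits at `1` (custodians' KNIFE-EDGES §1; `≈ 1 + 1/(2A+1)` at `p ≈ D^A`). NOT the skeleton's
`Skeleton.ell D = 𝓛 = log D` (here `Scales.logD`). [cite: Zhang2022LandauSiegel, §2 (2.10), (2.30)] -/
def ell (p : ℝ) : ℝ := S.LRefl p / S.LDelta p

/-- `ℓ > 1` whenever `D > 4π²` (and `p√D·t₀ > 1`, so that `L_Δ > 0`): the reflection length exceeds
the zero-spacing length, always. [cite: Zhang2022LandauSiegel, §2 (2.10), (2.30)] -/
theorem one_lt_ell {p : ℝ} (hp : 0 < p) (ht : 0 < S.t0) (hD : 4 * π ^ 2 < S.D)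
    (hbig : 1 < p * Real.sqrt S.D * S.t0) : 1 < S.ell p := by
  have hπ : 0 < π := Real.pi_pos
  have hD0 : (0 : ℝ) < S.D := lt_trans (by positivity) hD
  have hsq : 2 * π < Real.sqrt S.D := by
    rw [show 4 * π ^ 2 = (2 * π) ^ 2 by ring] at hD
    exact (Real.lt_sqrt (by positivity)).mpr hD
  have hΔ : 0 < S.LDelta p := Real.log_pos hbig
  rw [ell, one_lt_div hΔ, LDelta, LRefl]
  apply Real.log_lt_log (by positivity)
  rw [lt_div_iff₀ (by positivity)]
  have hsqD : Real.sqrt S.D * Real.sqrt S.D = S.D := Real.mul_self_sqrt hD0.le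
  nlinarith [mul_pos hp ht, Real.sqrt_nonneg (S.D : ℝ), mul_pos (mul_pos hp ht) (sub_pos.mpr hsq)]

/-- `ℓ − 1 = (log √D − log 2π)/L_Δ` (so `ℓ − 1 ≈ (½ log D)/(A + ½) log D = 1/(2A+1)` at `p ≈ D^A`,
`t₀ = D^{o(1)}`). [cite: Zhang2022LandauSiegel, §2 (2.10), (2.30)] -/
theorem ell_sub_one {p : ℝ} (hp : 0 < p) (ht : 0 < S.t0) (hD : (0 : ℝ) < S.D)
    (hΔ : S.LDelta p ≠ 0) :
    S.ell p - 1 = (Real.log (Real.sqrt S.D) - Real.log (2 * π)) / S.LDelta p := by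
  have hπ : 0 < π := Real.pi_pos
  have hsD : 0 < Real.sqrt S.D := Real.sqrt_pos.mpr hD
  rw [ell, div_sub_one hΔ, LRefl, LDelta]
  congr 1
  have key : p * S.D * S.t0 / (2 * π) = (p * Real.sqrt S.D * S.t0) * Real.sqrt S.D / (2 * π) := by
    have h := Real.mul_self_sqrt hD.le
    calc p * S.D * S.t0 / (2 * π) = p * (Real.sqrt S.D * Real.sqrt S.D) * S.t0 / (2 * π) := by rw [h]
      _ = (p * Real.sqrt S.D * S.t0) * Real.sqrt S.D / (2 * π) := by ring
  rw [key, Real.log_div (by positivity) (by positivity), Real.log_mul (by positivity) hsD.ne']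
  ring

/-! ## The family `Ψ` at scale `S` -/

/-- The prime window "`p ∼ P`: `P < p < P(1+η)`" at scale `S` (same shape as `Skeleton.primeWindow`).
[cite: Zhang2022LandauSiegel, §2 p.4] -/
def primeWindow : Finset ℕ := (Finset.Ioo ⌊S.P⌋₊ ⌈S.P * (1 + S.eta)⌉₊).filter Nat.Prime

/-- The pinned window is the skeleton's. [cite: Zhang2022LandauSiegel, §2 p.4] -/
theorem pinned_primeWindow (D : ℕ) : (pinned D).primeWindow = Skeleton.primeWindow D := rfl

/-- `𝔓 = Σ_{p∼P} p` (2.9) at scale `S`. [cite: Zhang2022LandauSiegel, §2 (2.9)] -/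
def frakP : ℝ := ∑ p ∈ S.primeWindow, (p : ℝ)

/-- The pinned `𝔓` is the tree's `frakP D`. [cite: Zhang2022LandauSiegel, §2 (2.9)] -/
theorem pinned_frakP (D : ℕ) : (pinned D).frakP = Zhang2022.frakP D := by
  rw [frakP, pinned_primeWindow, ← Skeleton.frakP_eq_sum_primeWindow]

/-- Members of the window are prime ("`p` and `q` denote primes", §2 p.3; `p ∼ P`). [cite: Zhang2022LandauSiegel, §2 p.4] -/
theorem prime_of_mem_primeWindow {p : ℕ} (h : p ∈ S.primeWindow) : p.Prime := (Finset.mem_filter.mp h).2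

end Scales

/-- **The family `Ψ` at scale `S`**: a prime `p` of the window with a primitive character `ψ (mod p)`
(same shape as `Skeleton.Chr`). [cite: Zhang2022LandauSiegel, §2 p.4] -/
structure Chr (S : Scales) where
  /-- the modulus `p ∼ P` -/
  p : ℕ
  /-- `P < p < P(1+η)`, `p` prime -/
  mem : p ∈ S.primeWindow
  /-- the character `ψ (mod p)` -/
  ψ : DirichletCharacter ℂ p
  /-- `ψ` is primitive -/
  prim : ψ.IsPrimitive

namespace Chr

variable {S : Scales}

/-- The modulus of a member of `Ψ` is prime. [cite: Zhang2022LandauSiegel, §2 p.4] -/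
theorem prime (x : Chr S) : x.p.Prime := S.prime_of_mem_primeWindow x.mem

/-- The modulus of a member of `Ψ` is non-zero (a `NeZero` witness, kept as a theorem; use `haveI`): `p ∼ P` is prime. [cite: Zhang2022LandauSiegel, §2 p.4] -/
theorem neZero (x : Chr S) : NeZero x.p := ⟨x.prime.ne_zero⟩

/-- `Ψ` embeds in `Σ_{p ∼ P} (characters mod p)`. [folklore] -/
def toSigma (x : Chr S) : (q : S.primeWindow) × DirichletCharacter ℂ (q : ℕ) := ⟨⟨x.p, x.mem⟩, x.ψ⟩

/-- `toSigma` is injective. [folklore] -/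
private theorem toSigma_injective : Function.Injective (toSigma (S := S)) := by
  rintro ⟨p, hp, ψ, hψ⟩ ⟨p', hp', ψ', hψ'⟩ h
  simp only [toSigma, Sigma.mk.injEq, Subtype.mk.injEq] at h
  obtain ⟨rfl, h2⟩ := h
  simp only [heq_eq_eq] at h2
  subst h2; rfl

/-- **`Ψ` is finite** at every scale (finitely many primes in the window, finitely many characters each);
stated as a theorem — use `haveI := Chr.finite` where a `Finite` instance is wanted ("the family `Ψ` of all primitive characters `ψ (mod p)` with `p ∼ P`", finitely many). [cite: Zhang2022LandauSiegel, §2 p.4] -/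
theorem finite : Finite (Chr S) := by
  haveI : ∀ q : S.primeWindow, NeZero (q : ℕ) := fun q => ⟨(S.prime_of_mem_primeWindow q.2).ne_zero⟩
  exact Finite.of_injective _ toSigma_injective

end Chr

/-! ## Zeros, shifts, weights at scale `S` -/

section Objects

/-- `β₁ = iα(1 − 5c′α𝓛)` (2.13) at scale `S` (`α = π/log P`, `𝓛 = log D`). [cite: Zhang2022LandauSiegel, §2 (2.13)] -/
def beta1 (c' : ℝ) (S : Scales) : ℂ := I * (S.alpha : ℂ) * (1 - 5 * c' * S.alpha * S.logD : ℝ)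

/-- `β₂ = 2iα(1 + c′α𝓛)` (2.13) at scale `S`. [cite: Zhang2022LandauSiegel, §2 (2.13)] -/
def beta2 (c' : ℝ) (S : Scales) : ℂ := 2 * I * (S.alpha : ℂ) * (1 + c' * S.alpha * S.logD : ℝ)

/-- `β₃ = 3iα(1 − c′α𝓛)` (2.13) at scale `S`. [cite: Zhang2022LandauSiegel, §2 (2.13)] -/
def beta3 (c' : ℝ) (S : Scales) : ℂ := 3 * I * (S.alpha : ℂ) * (1 - c' * S.alpha * S.logD : ℝ)

/-- The pinned shifts are the skeleton's. [cite: Zhang2022LandauSiegel, §2 (2.13)] -/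
theorem pinned_beta (c' : ℝ) (D : ℕ) :
    beta1 c' (Scales.pinned D) = Skeleton.beta1 c' D ∧ beta2 c' (Scales.pinned D) = Skeleton.beta2 c' D ∧
      beta3 c' (Scales.pinned D) = Skeleton.beta3 c' D := by
  refine ⟨?_, ?_, ?_⟩ <;>
    simp only [beta1, beta2, beta3, Skeleton.beta1, Skeleton.beta2, Skeleton.beta3, Scales.pinned_alpha] <;> rfl

/-- `L(s,ψ)` for a member of `Ψ` (the `NeZero p` witness supplied from primality). [cite: Zhang2022LandauSiegel, §2 (2.14)] -/
def Chr.L {S : Scales} (x : Chr S) : ℂ → ℂ := haveI := x.neZero; x.ψ.LFunction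

/-- `M(s,ψ) = Y(s,ψ)L(s,ψ)` for a member of `Ψ` (`Skeleton.Mfun`). [cite: Zhang2022LandauSiegel, §2 p.5] -/
def Chr.M {S : Scales} (x : Chr S) : ℂ → ℂ := haveI := x.neZero; Skeleton.Mfun x.ψ

/-- **`𝔷(ψ)` at scale `S`** (2.14): the zeros of `L(s,ψ)` with `|σ − 1/2| < 1/2`, `|t − 2πt₀| < 𝓛₁`.
[cite: Zhang2022LandauSiegel, §2 (2.14)] -/
def zeroSet {S : Scales} (x : Chr S) : Set ℂ :=
  {ρ | |ρ.re - 1 / 2| < 1 / 2 ∧ |ρ.im - 2 * π * S.t0| < S.L1 ∧ x.L ρ = 0}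

/-- `L(s,ψχ)` for a member of `Ψ`: `ψχ` to the modulus `Dp` via `changeLevel` (as `Skeleton.psiChi`).
[cite: Zhang2022LandauSiegel, §4 p.8] -/
def Chr.Lchi {S : Scales} {D : ℕ} [NeZero D] (χ : DirichletCharacter ℂ D) (x : Chr S) : ℂ → ℂ :=
  haveI : NeZero (D * x.p) := ⟨mul_ne_zero (NeZero.ne D) x.prime.ne_zero⟩;
  (DirichletCharacter.changeLevel (dvd_mul_right D x.p) χ *
    DirichletCharacter.changeLevel (dvd_mul_left x.p D) x.ψ).LFunction

/-- The zeros of the product `L(s,ψ)L(s,ψχ)` in the same window (the set Proposition 2.2 is about, at scale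
`S`). [cite: Zhang2022LandauSiegel, §2 Prop. 2.2] -/
def prodZeroSet {S : Scales} {D : ℕ} [NeZero D] (χ : DirichletCharacter ℂ D) (x : Chr S) : Set ℂ :=
  {ρ | |ρ.re - 1 / 2| < 1 / 2 ∧ |ρ.im - 2 * π * S.t0| < S.L1 ∧ x.L ρ * x.Lchi χ ρ = 0}

/-- **`𝔠*(ρ,ψ) = −iM(ρ+β₁,ψ)M(ρ+β₂,ψ)M(ρ+β₃,ψ)/M′(ρ,ψ)`** at scale `S` (same formula as `Skeleton.cstar`,
`M = Skeleton.Mfun`). [cite: Zhang2022LandauSiegel, §2 p.5] -/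
def cstar (c' : ℝ) (S : Scales) (x : Chr S) (ρ : ℂ) : ℂ :=
  -I * x.M (ρ + beta1 c' S) * x.M (ρ + beta2 c' S) * x.M (ρ + beta3 c' S) / deriv x.M ρ

/-- **`ω(s)`** (2.15) at scale `S`: `SmoothWeight.omega 𝓛₂ t₀`. [cite: Zhang2022LandauSiegel, §2 (2.15)] -/
def omegaW (S : Scales) (s : ℂ) : ℂ := SmoothWeight.omega S.L2 S.t0 s

/-- The pinned weight is the skeleton's. [cite: Zhang2022LandauSiegel, §2 (2.15)] -/
theorem pinned_omegaW (D : ℕ) (s : ℂ) : omegaW (Scales.pinned D) s = Skeleton.omegaW D s := rfl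

/-! ### The pinned record reproduces the skeleton's objects (nothing is restated) -/

/-- A member of `Ψ` at the pinned scales IS a member of the skeleton's `Ψ` (same window). [cite: Zhang2022LandauSiegel, §2 p.4] -/
def Chr.toSkeleton {D : ℕ} (x : Chr (Scales.pinned D)) : Skeleton.Chr D := ⟨x.p, x.mem, x.ψ, x.prim⟩

/-- At the pinned scales `𝔷(ψ)` is the skeleton's `Skeleton.zeroSet`. [cite: Zhang2022LandauSiegel, §2 (2.14)] -/
theorem pinned_zeroSet {D : ℕ} (x : Chr (Scales.pinned D)) : zeroSet x = Skeleton.zeroSet D x.toSkeleton := rfl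

/-- At the pinned scales `𝔠*` is the skeleton's `Skeleton.cstar`. [cite: Zhang2022LandauSiegel, §2 p.5] -/
theorem pinned_cstar (c' : ℝ) {D : ℕ} (x : Chr (Scales.pinned D)) (ρ : ℂ) :
    cstar c' (Scales.pinned D) x ρ = Skeleton.cstar c' D x.toSkeleton ρ := by
  obtain ⟨h1, h2, h3⟩ := pinned_beta c' D
  simp only [cstar, Skeleton.cstar, h1, h2, h3]
  rfl

end Objects

/-! ## Dirichlet polynomials of a profile, and the discrete pairing -/

section Pairing

variable {D : ℕ} [NeZero D] (χ : DirichletCharacter ℂ D)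

/-- The coefficient `ψχ(n)` (2.23) for a member of `Ψ` at scale `S` (= `Skeleton.pc` at the pinned scales,
`pinned_pc`). [cite: Zhang2022LandauSiegel, §2 (2.23)] -/
def pc {S : Scales} (x : Chr S) (n : ℕ) : ℂ := x.ψ (n : ZMod x.p) * χ (n : ZMod D)

/-- **The profile polynomial at scale `S`**: `Σ_{1 ≤ n < N} ψχ(n)·g(log n/log P)·n^{−s}` — the free-scale twin of
`KnifeEdge.profPoly` (same argument order; there `log P = 𝓛⁹`). The manuscript's `H₁ⱼ` (2.23)–(2.25) and `J₁` (2.29)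
have this shape with the twist `(P_j/n)^{ikα} = e^{iπk(ν_j − z)}` absorbed into the complex profile `g(z)`,
`z = log n/log P`; `N = ⌈P^{top}⌉` for a piece of logarithmic length `top`. [cite: Zhang2022LandauSiegel, §2 (2.23)–(2.29)] -/
def profPoly {S : Scales} (x : Chr S) (g : ℝ → ℂ) (N : ℕ) (s : ℂ) : ℂ :=
  ∑ n ∈ Finset.Ico 1 N, pc χ x n * g (Real.log n / S.logP) * (n : ℂ) ^ (-s)

/-- **The discrete mean at scale `S`** of a family of values `u(ψ,ρ)` over a finite sub-family `F ⊆ Ψ`: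
`Σ_{ψ∈F} Σ_{ρ∈𝔷(ψ)} Re 𝔠*(ρ,ψ)·‖u(ψ,ρ)‖²·Re ω(ρ)` — the free-scale twin of `KnifeEdge.discMean` (which sums over
`Skeleton.idx χ = Ψ₁ × zeros`); the inner sum runs over `Skeleton.finsetOf (zeroSet x)` (junk `∅` were the zero set
infinite, as in `Skeleton.idx`). The manuscript's `Ξ₁₁`, `Ξ_J` ((8.3), (2.33)) are such means.
[cite: Zhang2022LandauSiegel, §2 (2.16)–(2.20), §8 (8.3)] -/
def discMean (c' : ℝ) (S : Scales) (F : Finset (Chr S)) (u : Chr S → ℂ → ℂ) : ℝ :=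
  ∑ x ∈ F, ∑ ρ ∈ Skeleton.finsetOf (zeroSet x), (cstar c' S x ρ).re * ‖u x ρ‖ ^ 2 * (omegaW S ρ).re

/-- The polar (sesquilinear) discrete pairing at scale `S`:
`Σ_{ψ∈F} Σ_{ρ∈𝔷(ψ)} 𝔠*(ρ,ψ)·u(ψ,ρ)·conj v(ψ,ρ)·ω(ρ)` — the shape of `Ξ₁*` (2.17) and `Ξ₁₃` (8.5).
[cite: Zhang2022LandauSiegel, §2 (2.17), §8 (8.5)] -/
def discPolar (c' : ℝ) (S : Scales) (F : Finset (Chr S)) (u v : Chr S → ℂ → ℂ) : ℂ :=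
  ∑ x ∈ F, ∑ ρ ∈ Skeleton.finsetOf (zeroSet x), cstar c' S x ρ * u x ρ * conj (v x ρ) * omegaW S ρ

/-- The normaliser `𝔞·𝔓` of (2.31)–(2.34) at scale `S` (`𝔞 = Lemma171.frakA χ` depends on `D` only).
[cite: Zhang2022LandauSiegel, §2 (2.31)] -/
def normaliser (S : Scales) : ℝ := Lemma171.frakA χ * S.frakP

/-- **The normalised discrete mean of a profile** at scale `S` over the sub-family `F`:
`Ξ_F(H_g, H_g)/(𝔞𝔓)` with `H_g = profPoly χ x g N` sampled AT the zeros `ρ` (the shape of `Skeleton.xi11/(𝔞𝔓)`,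
(8.3)/(2.32); the shifts `β_j` live in the twisted profile) — the quantity whose (A)-world main term the dictionary
identifies with a value of `𝔅 = mainTermForm` (pinned scales, `Skeleton.Eval823`-type rows) resp. of
`F_ℓ = mainTermFormEll ℓ` (free scales, the custodians' reading of the edge `ℓ₀ = 1`).
[cite: Zhang2022LandauSiegel, §2 (2.18), (2.32); §8 (8.3)] -/
def profileMean (c' : ℝ) (S : Scales) (F : Finset (Chr S)) (g : ℝ → ℂ) (N : ℕ) : ℝ :=
  discMean c' S F (fun x ρ => profPoly χ x g N ρ) / normaliser χ S

/-! ### At the pinned scales these are the skeleton's / `KnifeEdge`'s objects -/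

/-- The two descriptions of `Ψ` at the manuscript's scales coincide: `Chr (Scales.pinned D) ≃ Skeleton.Chr D`
(same window, same data). [cite: Zhang2022LandauSiegel, §2 p.4] -/
def Chr.pinnedEquiv (D : ℕ) : Chr (Scales.pinned D) ≃ Skeleton.Chr D where
  toFun x := x.toSkeleton
  invFun y := ⟨y.p, y.mem, y.ψ, y.prim⟩
  left_inv _ := rfl
  right_inv _ := rfl

omit [NeZero D] in
/-- At the pinned scales `ψχ(n)` is `Skeleton.pc`. [cite: Zhang2022LandauSiegel, §2 (2.23)] -/
theorem pinned_pc (x : Chr (Scales.pinned D)) (n : ℕ) : pc χ x n = Skeleton.pc χ x.toSkeleton n := rfl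

omit [NeZero D] in
/-- At the pinned scales the profile polynomial is `KnifeEdge.profPoly`. [cite: Zhang2022LandauSiegel, §2 (2.23)–(2.29)] -/
theorem pinned_profPoly (x : Chr (Scales.pinned D)) (g : ℝ → ℂ) (N : ℕ) (s : ℂ) :
    profPoly χ x g N s = KnifeEdge.profPoly χ x.toSkeleton g N s := by
  unfold profPoly KnifeEdge.profPoly
  rw [← Scales.pinned_P, Scales.P, Real.log_exp]
  rfl

omit [NeZero D] in
/-- At the pinned scales the summand of the discrete mean is the skeleton's (`𝔠*`, `ω`, `𝔷(ψ)` all agree: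
`pinned_cstar`, `pinned_omegaW`, `pinned_zeroSet`), so `discMean c' (pinned D) F u` is `KnifeEdge.discMean`'s
double sum restricted to the sub-family `F` (there: `F = Ψ₁`). [cite: Zhang2022LandauSiegel, §2 (2.16)–(2.20)] -/
theorem pinned_discMean_summand (c' : ℝ) (x : Chr (Scales.pinned D)) (u : ℂ → ℂ) (ρ : ℂ) :
    (cstar c' (Scales.pinned D) x ρ).re * ‖u ρ‖ ^ 2 * (omegaW (Scales.pinned D) ρ).re =
      (Skeleton.cstar c' D x.toSkeleton ρ).re * ‖u ρ‖ ^ 2 * (Skeleton.omegaW D ρ).re := by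
  rw [pinned_cstar, pinned_omegaW]

end Pairing

end Literature.NumberTheory.LFunctions.Zhang2022.EllScales

end
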